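import Literature.NumberTheory.EllipticCurves.ZpExtensionEisensteinSelmerStructureProofs
import Literature.NumberTheory.EllipticCurves.ZpExtensionScalarTwistResidualQuotient
import Literature.NumberTheory.EllipticCurves.TowerLiftableConnectingProofs
import HarnessLib

/-!
# No invariants in the graded tower `W_j / Fil_w W_j` at a non-anomalous place: all levels from level `1`, and level `1`
# from «`σ₀` acts on `gr_w M₁` by a scalar `n₀ ≢ 1 (mod p)`» (theorems only; no definition, no named fact, no instance, no `sorry`)

Topic `NumberTheory/EllipticCurves` (D1 road of cell `pub/bsd-print-x9`; brick (D3) = the INVARIANTS input (`hH0` of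
`Tower.map_apply_eq_zero_of_mem_saturatedFamilies_ker`, `hinv` of x10b-p1-w6's `Tower.map_quotFamily_injective_of_forall_invariant_eq_zero`)
of Howard's H.5(b) at the places `w ∣ p`, NON-ANOMALOUS case; memo `HOME/x9-p1-w3/H5B-AT-P-PLAN-w3g5.md` (H0); seat
`bsd-line-x10b-p1-w8` g2's (H5B-P)).

Howard [B. Howard, Compositio Math. 140 (2004), Lemma 3.2.7, arXiv:1202.6340 p. 16 L156–158 and p. 17 L14–29]: the correction
terms of the ordinary condition at `v ∣ p` are controlled by `H⁰(K_v, gr_v ·)`, «isomorphic to the `p`-power torsion of the reduction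
of `E` at `v` rational over the residue field of `K_v`» — ZERO in the non-anomalous case `a_v ≢ 1 (mod p)`.  In the tree's
finite-level currency this is the vanishing of the `Γ_{K_w}`-invariants of the quotients `G_j = W_j / Fil_w W_j`
(`W_j = M_j ⊗ A_{m,j}(ψ)`, `Fil_w W_j = OrdinaryFiltration.twistedFil`), at EVERY level `j`:

* §1 (generic, any presented tower `(G, g)` with injective upward maps and exact rows `0 → G ℓ → G (ℓ+n) → G n → 0`)
  **`Tower.eq_zero_of_mem_invariants_of_level_one`** — if `G 0` and `G 1` have no non-zero invariants then no `G a` has: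
  induction on `a` along the rows `0 → G a → G (a+1) → G 1 → 0` (an invariant of `G (a+1)` dies in `G 1`, so comes from
  `G a`, where it is invariant by injectivity).
* §2 (level `1`, the module `W₁ = M₁ ⊗ A_{m,1}(ψ)` of ANY tower `(M_k, t_k)` with ordinary datum `Φ` at `w`, `m ≥ 1`):
  **`OrdinaryFiltration.mem_twistedFil_one_of_toLocal_apply_sub_mem`** — if some `σ₀ ∈ Γ_{K_w}` acts on `M₁` modulo `Fil_w M₁`
  as an integer scalar `n₀` with `p ∤ n₀ − 1` (for `M₁ = E[p]`: `σ₀` acts on the LINE `gr_w E[p] = Ẽ_w[p]` by `n₀ ≢ 1`, i.e.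
  `Ẽ_w[p]^{Γ_w} = 0` — non-anomalous), then `σ₀ x − x ∈ Fil_w W₁ ⇒ x ∈ Fil_w W₁`: modulo `Fil_w W₁`, `σ₀ − 1` acts on `W₁` as the
  scalar `n₀ (1+T)^{e} − 1`, a UNIT of the local ring `A_{m,1}` (its residue is `n₀ − 1 ≠ 0`); hence
  **`OrdinaryFiltration.quotient_twistedFil_one_eq_zero_of_forall_apply_eq`** — the quotient `W₁ / Fil_w W₁` has no non-zero
  `Γ_{K_w}`-invariants (the `n = 1` instance of the `hinv` binder).

No summit statement is proved; BSD is not proved by any of this.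

References: [Howard2004HeegnerKolyvagin] Lemma 3.2.7 (arXiv:1202.6340 p. 16 L150–158, p. 17 L14–29), §3.1 (p. 15 L56–66), Rem. 1.1.4;
[GreenbergLNM1716] §2 (the ordinary filtration; anomalous primes); [SerreGaloisCohomology1997] I §2.2.
-/

set_option autoImplicit false

noncomputable section

open Function NumberField IsDedekindDomain Field
open scoped NumberField TensorProduct ContRepresentation

namespace Literature.NumberTheory.EllipticCurves

/-! ## §1 Generic: no invariants at levels `0`, `1` ⇒ no invariants at any level -/

namespace Tower

open Literature.NumberTheory.GaloisRepresentations

universe u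

variable {F : Type u} [Field F]
variable {G : ℕ → Type u} [∀ j, AddCommGroup (G j)] [∀ j, TopologicalSpace (G j)] [∀ j, DiscreteTopology (G j)]
variable (ρG : ∀ j, DiscreteGaloisModule F (G j))
variable (g : ∀ a b, (ρG a).toContRepresentation →ⁱL (ρG b).toContRepresentation)

/-- **No invariants at levels `0` and `1` ⇒ no invariants at any level**, for a presented tower with injective upward maps
and exact rows `0 → G ℓ → G (ℓ+n) → G n → 0`: an invariant `x ∈ G (a+1)` maps to an invariant of `G 1`, hence to `0`, so
`x = g a (a+1) y` with `y` invariant (injectivity), and `y = 0` by induction.  (Left exactness of `H⁰` along the `p`-adic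
dévissage `G (a+1) ⊃ G a`, graded piece `G 1`.) [cite: Howard2004HeegnerKolyvagin, Lemma 3.2.7 (arXiv:1202.6340 p. 17 L14–29: H⁰(K_v, gr_v A_𝔭) bounded through H⁰(K_v, gr_v A))]
[cite: SerreGaloisCohomology1997, Ch. I §2.2] -/
theorem eq_zero_of_mem_invariants_of_level_one
    (hinj : ∀ ℓ n, Function.Injective (g ℓ (ℓ + n)))
    (hex : ∀ ℓ n (y : G (ℓ + n)), g (ℓ + n) n y = 0 ↔ ∃ x, g ℓ (ℓ + n) x = y)
    (h0 : ∀ x : G 0, x ∈ (ρG 0).toTopRep.ρ.invariants → x = 0)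
    (h1 : ∀ x : G 1, x ∈ (ρG 1).toTopRep.ρ.invariants → x = 0)
    (a : ℕ) (x : G a) (hx : x ∈ (ρG a).toTopRep.ρ.invariants) : x = 0 := by
  induction a with
  | zero => exact h0 x hx
  | succ a ih =>
    -- the image in `G 1` is invariant, hence `0`
    have himg : g (a + 1) 1 x ∈ (ρG 1).toTopRep.ρ.invariants := fun σ ↦ by
      change ρG 1 σ (g (a + 1) 1 x) = g (a + 1) 1 x
      rw [← apply_smul_eq ρG g (a + 1) 1 σ x]
      exact congrArg (g (a + 1) 1) (hx σ)
    have hzero : g (a + 1) 1 x = 0 := h1 _ himg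
    -- so `x` comes from `G a`, from an invariant
    obtain ⟨y, rfl⟩ := (hex a 1 x).mp hzero
    have hy : y ∈ (ρG a).toTopRep.ρ.invariants := mem_invariants_of_apply_mem ρG g hinj (Nat.le_succ a) y hx
    rw [ih y hy, map_zero]

end Tower

/-! ## §2 Level `1`: no invariants in `W₁ / Fil_w W₁` when `σ₀` acts on `gr_w M₁` by `n₀ ≢ 1 (mod p)` -/

namespace ZpExtension

open Literature.NumberTheory.GaloisRepresentations Literature.NumberTheory.GaloisRepresentations.DiscreteGaloisModule
open Literature.NumberTheory.EllipticCurves.IwasawaAlgebra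

variable {K : Type} [Field K] [NumberField K] {p : ℕ} [hp : Fact p.Prime] (κ : ZpExtension K p)
  {M : ℕ → Type} [∀ k, AddCommGroup (M k)] [∀ k, TopologicalSpace (M k)] [∀ k, DiscreteTopology (M k)]
  {ρ : ∀ k, DiscreteGaloisModule K (M k)}
  {t : ∀ k, (ρ (k + 1)).toContRepresentation →ⁱL (ρ k).toContRepresentation} {m : ℕ} (hm : 1 ≤ m)
  {w : HeightOneSpectrum (𝓞 K)} (Φ : OrdinaryFiltration ρ t w)

namespace OrdinaryFiltration

/-- **`σ₀ − 1` acts on `W₁` as the scalar `n₀ (1+T)^e − 1` modulo `Fil_w W₁`**, if `σ₀` acts on `M₁` as the integer `n₀` modulo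
`Fil_w M₁`: on a pure tensor, `σ₀ (c ⊗ a) − c ⊗ a − (n₀ (1+T)^e − 1) • (c ⊗ a) = (1+T)^e c ⊗ (σ₀ a − n₀ a) ∈ A ⊗ Fil`.
[cite: Howard2004HeegnerKolyvagin, §2.2 and §3.1 (arXiv:1202.6340 p. 15: the action on T_𝔮 = T ⊗ S_𝔮(ψ))] -/
theorem toLocal_apply_sub_sub_smul_mem_twistedFil_one (σ₀ : absoluteGaloisGroup (w.adicCompletion K)) (n₀ : ℤ)
    (hσ₀ : ∀ a : M 1, GaloisRep.toLocal w (ρ 1) σ₀ a - n₀ • a ∈ Φ.fil 1)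
    (x : EisensteinCoeff.Twisted p m 1 (M 1)) :
    GaloisRep.toLocal w (κ.eisensteinTwist (ρ 1) hm 1) σ₀ x - x -
        ((n₀ : EisensteinCoeff p m 1) * EisensteinCoeff.onePlusT p m 1 ^
            κ.twistExponent (eisensteinLevel (p := p) hm 1) (absGaloisRestrict K (w.adicCompletion K) σ₀) - 1) • x ∈
      Φ.twistedFil 1 := by
  set ue : EisensteinCoeff p m 1 := EisensteinCoeff.onePlusT p m 1 ^
    κ.twistExponent (eisensteinLevel (p := p) hm 1) (absGaloisRestrict K (w.adicCompletion K) σ₀) with hue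
  induction x using EisensteinCoeff.Twisted.induction_on with
  | zero => rw [map_zero, sub_zero, smul_zero, sub_zero]; exact zero_mem _
  | tmul c a =>
    rw [GaloisRep.toLocal_apply, κ.eisensteinTwist_apply_tmul (ρ 1) hm 1]
    -- additivity of `tmul` in each argument
    let φ : M 1 →+ EisensteinCoeff.Twisted p m 1 (M 1) :=
      { toFun := fun b ↦ EisensteinCoeff.Twisted.tmul (ue * c) b
        map_zero' := TensorProduct.tmul_zero _ _
        map_add' := fun b b' ↦ TensorProduct.tmul_add _ _ _ }
    let ψ : EisensteinCoeff p m 1 →+ EisensteinCoeff.Twisted p m 1 (M 1) :=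
      { toFun := fun d ↦ EisensteinCoeff.Twisted.tmul d a
        map_zero' := TensorProduct.zero_tmul _ _
        map_add' := fun d d' ↦ TensorProduct.add_tmul _ _ _ }
    -- `σ₀ a = n₀ a + f₀`, `f₀ ∈ Fil`
    have hdecomp : ρ 1 (absGaloisRestrict K (w.adicCompletion K) σ₀) a =
        n₀ • a + (GaloisRep.toLocal w (ρ 1) σ₀ a - n₀ • a) := by
      rw [GaloisRep.toLocal_apply, add_sub_cancel]
    have h1 : EisensteinCoeff.Twisted.tmul (p := p) (m := m) (k := 1) (ue * c) (ρ 1 (absGaloisRestrict K (w.adicCompletion K) σ₀) a) =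
        EisensteinCoeff.Twisted.tmul ((n₀ : EisensteinCoeff p m 1) * (ue * c)) a +
          EisensteinCoeff.Twisted.tmul (ue * c) (GaloisRep.toLocal w (ρ 1) σ₀ a - n₀ • a) := by
      change φ (ρ 1 (absGaloisRestrict K (w.adicCompletion K) σ₀) a) = _
      rw [hdecomp, map_add, map_zsmul]
      change n₀ • EisensteinCoeff.Twisted.tmul (ue * c) a + EisensteinCoeff.Twisted.tmul (ue * c) _ = _
      rw [← Int.cast_smul_eq_zsmul (EisensteinCoeff p m 1) n₀, EisensteinCoeff.Twisted.smul_tmul]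
    rw [h1, EisensteinCoeff.Twisted.smul_tmul]
    have h3 : EisensteinCoeff.Twisted.tmul (p := p) (m := m) (k := 1) ((n₀ : EisensteinCoeff p m 1) * (ue * c)) a -
        EisensteinCoeff.Twisted.tmul c a - EisensteinCoeff.Twisted.tmul (((n₀ : EisensteinCoeff p m 1) * ue - 1) * c) a = 0 := by
      change ψ _ - ψ c - ψ _ = 0
      rw [← map_sub, ← map_sub,
        show (n₀ : EisensteinCoeff p m 1) * (ue * c) - c - ((n₀ : EisensteinCoeff p m 1) * ue - 1) * c = 0 by ring, map_zero]
    have h2 : EisensteinCoeff.Twisted.tmul ((n₀ : EisensteinCoeff p m 1) * (ue * c)) a +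
          EisensteinCoeff.Twisted.tmul (ue * c) (GaloisRep.toLocal w (ρ 1) σ₀ a - n₀ • a) -
          EisensteinCoeff.Twisted.tmul c a -
          EisensteinCoeff.Twisted.tmul (((n₀ : EisensteinCoeff p m 1) * ue - 1) * c) a =
        EisensteinCoeff.Twisted.tmul (p := p) (m := m) (k := 1) (ue * c) (GaloisRep.toLocal w (ρ 1) σ₀ a - n₀ • a) := by
      calc _ = (EisensteinCoeff.Twisted.tmul (p := p) (m := m) (k := 1) ((n₀ : EisensteinCoeff p m 1) * (ue * c)) a -
            EisensteinCoeff.Twisted.tmul c a -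
            EisensteinCoeff.Twisted.tmul (((n₀ : EisensteinCoeff p m 1) * ue - 1) * c) a) +
            EisensteinCoeff.Twisted.tmul (ue * c) (GaloisRep.toLocal w (ρ 1) σ₀ a - n₀ • a) := by abel
        _ = _ := by rw [h3, zero_add]
    rw [h2]
    exact Φ.tmul_mem_twistedFil 1 _ (hσ₀ a)
  | add x y hx hy =>
    have heq : GaloisRep.toLocal w (κ.eisensteinTwist (ρ 1) hm 1) σ₀ (x + y) - (x + y) -
        ((n₀ : EisensteinCoeff p m 1) * ue - 1) • (x + y) =
        (GaloisRep.toLocal w (κ.eisensteinTwist (ρ 1) hm 1) σ₀ x - x - ((n₀ : EisensteinCoeff p m 1) * ue - 1) • x) +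
          (GaloisRep.toLocal w (κ.eisensteinTwist (ρ 1) hm 1) σ₀ y - y - ((n₀ : EisensteinCoeff p m 1) * ue - 1) • y) := by
      rw [map_add, smul_add]; abel
    rw [heq]
    exact add_mem hx hy

/-- **`σ₀ x − x ∈ Fil_w W₁ ⇒ x ∈ Fil_w W₁`** when `σ₀` acts on `M₁` modulo `Fil_w M₁` as an integer `n₀` with `p ∤ n₀ − 1`: by the
previous lemma `(n₀ (1+T)^e − 1) • x ∈ Fil_w W₁`, and `n₀ (1+T)^e − 1` is a UNIT of the local ring `A_{m,1}` (its image under the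
residue character `A_{m,1} → 𝔽_p` is `n₀ − 1 ≠ 0`).  For `M₁ = E[p]` at `w ∣ p` of good ordinary reduction the hypothesis says:
`σ₀` acts on the line `Ẽ_w[p]` by `n₀ ≢ 1 (mod p)` — the NON-ANOMALOUS condition `Ẽ_w[p]^{Γ_w} = 0`.
[cite: Howard2004HeegnerKolyvagin, Lemma 3.2.7 and Rem. 1.1.4 (arXiv:1202.6340 p. 16 L156–158: «H⁰(K_v, gr_v 𝐀) … the p-power torsion of the reduction of E … rational over the residue field»)]
[cite: GreenbergLNM1716, §2] -/
theorem mem_twistedFil_one_of_toLocal_apply_sub_mem (σ₀ : absoluteGaloisGroup (w.adicCompletion K)) (n₀ : ℤ)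
    (hn₀ : ¬ (p : ℤ) ∣ n₀ - 1) (hσ₀ : ∀ a : M 1, GaloisRep.toLocal w (ρ 1) σ₀ a - n₀ • a ∈ Φ.fil 1)
    (x : EisensteinCoeff.Twisted p m 1 (M 1))
    (hx : GaloisRep.toLocal w (κ.eisensteinTwist (ρ 1) hm 1) σ₀ x - x ∈ Φ.twistedFil 1) :
    x ∈ Φ.twistedFil 1 := by
  set v : EisensteinCoeff p m 1 := (n₀ : EisensteinCoeff p m 1) * EisensteinCoeff.onePlusT p m 1 ^
    κ.twistExponent (eisensteinLevel (p := p) hm 1) (absGaloisRestrict K (w.adicCompletion K) σ₀) - 1 with hv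
  -- `v • x ∈ Fil_w W₁`
  have hvx : v • x ∈ Φ.twistedFil (p := p) (m := m) 1 := by
    have h := Φ.toLocal_apply_sub_sub_smul_mem_twistedFil_one κ hm σ₀ n₀ hσ₀ x
    have heq : v • x = (GaloisRep.toLocal w (κ.eisensteinTwist (ρ 1) hm 1) σ₀ x - x) -
        (GaloisRep.toLocal w (κ.eisensteinTwist (ρ 1) hm 1) σ₀ x - x - v • x) := by abel
    rw [heq]
    exact sub_mem hx h
  -- `v` is a unit of the local ring `A_{m,1}`
  letI := EisensteinCoeff.isLocalRing_eisensteinCoeff p hm (le_refl 1)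
  have hres : EisensteinCoeff.residueChar p hm (le_refl 1) v ≠ 0 := by
    have hu : EisensteinCoeff.residueChar p hm (le_refl 1) (EisensteinCoeff.onePlusT p m 1 ^
        κ.twistExponent (eisensteinLevel (p := p) hm 1) (absGaloisRestrict K (w.adicCompletion K) σ₀)) = 1 := by
      rw [map_pow (EisensteinCoeff.residueChar p hm (le_refl 1)) (EisensteinCoeff.onePlusT p m 1),
        EisensteinCoeff.residueChar_onePlusT, one_pow]
    have hval : EisensteinCoeff.residueChar p hm (le_refl 1) v = ((n₀ - 1 : ℤ) : ZMod p) := by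
      rw [hv, map_sub (EisensteinCoeff.residueChar p hm (le_refl 1)), map_mul (EisensteinCoeff.residueChar p hm (le_refl 1)),
        hu, mul_one, map_one, map_intCast, Int.cast_sub, Int.cast_one]
    rw [hval, ne_eq, ZMod.intCast_zmod_eq_zero_iff_dvd]
    exact hn₀
  have hvunit : IsUnit v := by
    by_contra hnu
    have hmem : v ∈ IsLocalRing.maximalIdeal (EisensteinCoeff p m 1) :=
      (IsLocalRing.mem_maximalIdeal v).mpr (mem_nonunits_iff.mpr hnu)
    rw [EisensteinCoeff.maximalIdeal_eisensteinCoeff_eq p hm (le_refl 1), ← EisensteinCoeff.ker_residueChar p hm (le_refl 1),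
      RingHom.mem_ker] at hmem
    exact hres hmem
  obtain ⟨vu, hvu⟩ := hvunit
  have hx' : x = (vu⁻¹ : (EisensteinCoeff p m 1)ˣ) • (v • x) := by
    rw [← hvu, Units.smul_def, smul_smul, Units.inv_mul, one_smul]
  rw [hx']
  exact Φ.smul_mem_twistedFil 1 _ hvx

/-- **`(W₁ / Fil_w W₁)^{Γ_{K_w}} = 0` in the non-anomalous case** — the invariants of the quotient representation
`(GaloisRep.toLocal w W₁).quotient (Fil_w W₁)` vanish (it suffices that `σ₀` fixes the class): the `n = 1` instance of the
binder `hinv` of x10b-p1-w6's `Tower.map_quotFamily_injective_of_forall_invariant_eq_zero` and of `h1` in §1.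
[cite: Howard2004HeegnerKolyvagin, Lemma 3.2.7 (arXiv:1202.6340 p. 16 L156–158, p. 17 L14–29)] [cite: GreenbergLNM1716, §2] -/
theorem quotient_twistedFil_one_eq_zero_of_forall_apply_eq (σ₀ : absoluteGaloisGroup (w.adicCompletion K)) (n₀ : ℤ)
    (hn₀ : ¬ (p : ℤ) ∣ n₀ - 1) (hσ₀ : ∀ a : M 1, GaloisRep.toLocal w (ρ 1) σ₀ a - n₀ • a ∈ Φ.fil 1)
    (v : EisensteinCoeff.Twisted p m 1 (M 1) ⧸ Φ.twistedFil (p := p) (m := m) 1)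
    (hv : ∀ σ : absoluteGaloisGroup (w.adicCompletion K),
      (GaloisRep.toLocal w (κ.eisensteinTwist (ρ 1) hm 1)).quotient (Φ.twistedFil 1) (Φ.twistedFil_le_comap hm 1) σ v = v) :
    v = 0 := by
  induction v using Submodule.Quotient.induction_on with
  | _ x =>
    have h := hv σ₀
    rw [ContinuousRep.quotient_apply_mk, Submodule.Quotient.eq] at h
    exact (Submodule.Quotient.mk_eq_zero _).mpr
      (Φ.mem_twistedFil_one_of_toLocal_apply_sub_mem κ hm σ₀ n₀ hn₀ hσ₀ x h)

end OrdinaryFiltration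

end ZpExtension

end Literature.NumberTheory.EllipticCurves

end
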